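import Summits.AtomisticToContinuum.HydrodynamicLimit.Theorems.BoxDissipativeWeakStrongRelativeEnergyStabilityDefs
import Summits.AtomisticToContinuum.HydrodynamicLimit.Theorems.JParityClosureKineticEnergyTailsApriori
import Summits.AtomisticToContinuum.HydrodynamicLimit.Theorems.JParityClosureEvenStressEnskogRung0LocalStatisticsHelpers
import HarnessLib

/-!
# Crux `RelativeEnergyStability` (stmt-AtomisticToContinuum-17653), line `registered`:
stub `stub_localGibbsEnergyMoment` (S-E) — bounded mean kinetic energy per particle under the local Gibbs law

For continuous profiles `a₀, θ₀ > 0`, `u₀` on `𝕋³` we prove `RES.EnergyMomentFor a₀ u₀ θ₀`: with the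
finite constant `C = ofReal (U²/2 + 3Θ/2)`, `‖u₀‖ ≤ U`, `θ₀ ≤ Θ` (continuous functions on the compact
torus are bounded), for EVERY reduced diameter `σ > 0`, every `N` and every flow `Φ`,
`P_N(univ) ≤ 1` and `E_{P_N}[KE(z)/(N+1)] ≤ C`, `P_N = localGibbsLaw σ a₀ u₀ θ₀ N Φ`.

Proof. The law is the flow-free local Gibbs measure (`localGibbsLaw_eq`), whose total mass is
`Z_pos⁻¹ · Z_pos ≤ 1` (`localGibbsMeasure_univ_le_one`: `= 1` if the configurational partition
function is positive, the zero measure otherwise; no smallness of `σ` is used). The kinetic energy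
per particle `KE(z)/(N+1) = (N+1)⁻¹ Σᵢ ‖vᵢ‖²/2` is the mean of the one-body velocity observable
`f(v) = ‖v‖²/2`, so the disintegration bound `lintegral_meanVelObs_localGibbsMeasure_le` (positions
integrated against a sub-probability weight; given the positions `x` the velocities are independent
Gaussians `vᵢ ~ N(u₀(xᵢ), θ₀(xᵢ) id)`) reduces the claim to the single-Gaussian mean
`E_{N(u,θ id)} ‖v‖²/2 = ‖u‖²/2 + 3θ/2 ≤ U²/2 + 3Θ/2` on `ℝ³`
(`EvenStressEnskog.integral_half_norm_sq_gaussMeasure`).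
References: Spohn 1991, Part I §2.3 (local equilibrium states); BrezinaFeireisl2018 §3 (consumer:
the `N`-uniform energy bound feeding the Grönwall step of the weak–strong argument).
-/

noncomputable section

namespace Summit.AtomisticToContinuum.HydrodynamicLimit.Theorems.RES

open MeasureTheory Set
open scoped ENNReal
open Literature.MathematicalPhysics.KineticTheory Literature.Analysis.FluidPDE

variable {θ₀ : T3 → ℝ} {u₀ : T3 → V3}

/-- The single-Gaussian bound: for `‖u₀‖ ≤ U`, `0 < θ₀ ≤ Θ` and every `y ∈ 𝕋³`,
`∫ ‖w‖²/2 dN(u₀(y), θ₀(y) id) ≤ U²/2 + 3Θ/2` (as a lower integral). -/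
theorem em_lintegral_half_norm_sq_gaussMeasure_le (hθ0 : ∀ x, 0 < θ₀ x) {U Θ : ℝ}
    (hU : ∀ x, ‖u₀ x‖ ≤ U) (hΘ : ∀ x, θ₀ x ≤ Θ) (y : T3) :
    ∫⁻ w, ENNReal.ofReal (‖w‖ ^ 2 / 2) ∂gaussMeasure (u₀ y) (θ₀ y) ≤
      ENNReal.ofReal (U ^ 2 / 2 + 3 * Θ / 2) := by
  rw [← ofReal_integral_eq_lintegral_ofReal ((integrable_norm_sq_gaussMeasure _ _).div_const 2)
      (Filter.Eventually.of_forall fun w => by positivity),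
    EvenStressEnskog.integral_half_norm_sq_gaussMeasure (u₀ y) (hθ0 y)]
  refine ENNReal.ofReal_le_ofReal ?_
  have h1 : ‖u₀ y‖ ^ 2 ≤ U ^ 2 := pow_le_pow_left₀ (norm_nonneg _) (hU _) 2
  have h2 := hΘ y
  linarith

/-- The kinetic energy per particle is the mean of the one-body observable `‖v‖²/2`:
`KE(z)/(N+1) = (N+1)⁻¹ Σᵢ ‖vᵢ‖²/2`. -/
theorem em_energyPerParticle_eq (N : ℕ) (z : Config (N + 1) (Fin 3) T3) :
    ((N : ℝ) + 1)⁻¹ * configEnergy z = ((N : ℝ) + 1)⁻¹ * ∑ i, ‖(z i).2‖ ^ 2 / 2 := by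
  simp only [configEnergy, Finset.mul_sum]
  exact Finset.sum_congr rfl fun i _ => by ring

/-- **Stub S-E: bounded mean kinetic energy per particle under the local Gibbs law.** For continuous
profiles `a₀, θ₀ > 0` and `u₀` there is a finite `C` (namely `ofReal (U²/2 + 3Θ/2)` for bounds
`‖u₀‖ ≤ U`, `θ₀ ≤ Θ`) with `P_N(univ) ≤ 1` and `E_{P_N}[KE(z)/(N+1)] ≤ C` for every `σ > 0`, every `N`
and every flow, `P_N = localGibbsLaw σ a₀ u₀ θ₀ N Φ` (Spohn 1991, Part I §2.3; consumer
BrezinaFeireisl2018 §3). -/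
theorem stub_localGibbsEnergyMoment :
    ∀ (a₀ θ₀ : T3 → ℝ) (u₀ : T3 → V3), Continuous a₀ → Continuous θ₀ → Continuous u₀ →
      (∀ x, 0 < a₀ x) → (∀ x, 0 < θ₀ x) → EnergyMomentFor a₀ u₀ θ₀ := by
  intro a₀ θ₀ u₀ ha hθ hu ha0 hθ0
  have ha0' : ∀ x, 0 ≤ a₀ x := fun x => (ha0 x).le
  obtain ⟨U, hU⟩ := isCompact_univ.exists_bound_of_continuousOn hu.continuousOn
  obtain ⟨Θ, hΘ⟩ := isCompact_univ.exists_bound_of_continuousOn hθ.continuousOn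
  have hU' : ∀ x, ‖u₀ x‖ ≤ U := fun x => hU x (mem_univ x)
  have hΘ' : ∀ x, θ₀ x ≤ Θ := fun x => by
    have := hΘ x (mem_univ x)
    rw [Real.norm_eq_abs] at this
    exact (le_abs_self _).trans this
  refine ⟨ENNReal.ofReal (U ^ 2 / 2 + 3 * Θ / 2), ENNReal.ofReal_ne_top, fun σ _hσ N Φ => ?_⟩
  rw [localGibbsLaw_eq]
  refine ⟨localGibbsMeasure_univ_le_one ha hθ hu ha0' hθ0 σ N, ?_⟩
  simp_rw [em_energyPerParticle_eq N]
  exact lintegral_meanVelObs_localGibbsMeasure_le ha hθ hu ha0' hθ0 (f := fun v : V3 => ‖v‖ ^ 2 / 2)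
    ((measurable_norm.pow_const 2).div_const 2) (fun v => by positivity)
    (em_lintegral_half_norm_sq_gaussMeasure_le hθ0 hU' hΘ') σ N

end Summit.AtomisticToContinuum.HydrodynamicLimit.Theorems.RES

end
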